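import Summits.BirchSwinnertonDyer.BirchSwinnertonDyer.Theorems.ManinLocalTwoThreeEtaIdentitiesNinetySixA
import Summits.BirchSwinnertonDyer.BirchSwinnertonDyer.Theorems.ManinLocalTwoThreeNeronSqueeze
import Summits.BirchSwinnertonDyer.Rank1Residual.Additive.IntModelConductorCertificate
import HarnessLib

/-!
# Level 96 (`v₂(N) = 5`), class `96a`: the Néron squeeze for `96a1 = [0, 1, 0, -2, 0]` — `|c| = 1` for every `X₀(96)`-datum whose
# newform is `φ₉₆a`; `N(96a1) = 96` in the kernel

Cell bsd-f2-manin, route `ManinLocalTwoThree` (crux C2 `ManinOddAtFour` stmt-22967; `96 = 2⁵·3` is the first treated level of the charter's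
`v₂(N) ∈ {5,…,8}` cell — "twist-minimal classes with no semistable partner", where no CDT-free classical input was available), prover seat p3
gen 24; level-`96` instance of the general NÉRON SQUEEZE (`NeronSqueeze.abs_maninConstant_eq_one_of_periodLattice_le`) fed with (S2)₉₆a of
`EtaIdentitiesNinetySixA` (UNCONDITIONAL, E₂ road).

* §1 `96a1 = [0, 1, 0, -2, 0] : y² = x³ + x² − 2x`: elliptic, globally minimal (`Δ = 2⁶3²`), **`N(96a1) = 96`** by kernel certificates
  (type `III` at `2`: `2 ∣ a₃, a₄, a₆`, `4 ∣ a₆`, `2² ∥ b₈ = −4`, `f₂ = 6 + 1 − 2 = 5`; multiplicative at `3`: `3 ∣ Δ`, `3 ∤ c₄ = 112`), Néron invariants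
  `(c₄/12, c₆/216) = (28/3, -80/27)`;
* §2 **`abs_maninConstant_eq_one_ninetySixA_of_f_eq`**: for every globally minimal elliptic `W/ℚ` and every `X₀(96)`-datum `D` of `W` with the lattice
  clause AND `⇑D.f = φ₉₆a`: `|c(D)| = 1`, hence `2 ∤ c` (and `3 ∤ c`).

HONEST FRAMING: unconditional (standard axioms) but ONLY for data whose newform is `φ₉₆a`: the level-`96` statement needs the other class
and the newform pinning (an-g51 pinsolve-96), neither here.  C2 (`∀ N`), Manin's conjecture and BSD are NOT proved; item 22967 stays OPEN.
No definition, no named fact, no sorry. [cite: AgasheRibetStein2006, §§1–2] [cite: CremonaAlgorithms1997, Table 1 (96a1)] [cite: Silverman1994, IV.9.4]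
-/

set_option autoImplicit false
-- lint-debt: the directory name repeats the summit name (sibling precedent `ManinLocalTwoThreeNeronSqueezeSixtyFour.lean`)
set_option linter.dupNamespace false

noncomputable section

open Complex Filter Topology Set Function
open UpperHalfPlane hiding I
open scoped Real Topology Manifold MatrixGroups ModularForm
open ModularForm CongruenceSubgroup WeierstrassCurve
open Summit.BirchSwinnertonDyer.BirchSwinnertonDyer.Rank2Observatory
open Summit.BirchSwinnertonDyer.BirchSwinnertonDyer.Rank2Observatory.RootNumber
open Summit.BirchSwinnertonDyer.BirchSwinnertonDyer.Rank2Observatory.Tate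
open Summit.BirchSwinnertonDyer.Rank1Residual.Additive
open Literature.NumberTheory.EllipticCurves Literature.NumberTheory.EllipticCurves.ModularForms
open Literature.NumberTheory.Automorphic

namespace Summit.BirchSwinnertonDyer.BirchSwinnertonDyer.Theorems.ManinLocalTwoThree.NeronSqueezeNinetySixA

open EtaIdentitiesNinetySixA

/-! ## §1 `96a1` -/

/-- The literal `ℚ`-model read through integer casts. [folklore] -/
theorem mk_ninetySixA1_eq_cast : (⟨0, 1, 0, -2, 0⟩ : WeierstrassCurve ℚ) = ⟨((0 : ℤ) : ℚ), ((1 : ℤ) : ℚ), ((0 : ℤ) : ℚ), ((-2 : ℤ) : ℚ), ((0 : ℤ) : ℚ)⟩ := by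
  ext <;> norm_num

/-- `96a1` is globally minimal (`Δ = 2⁶·3²`; kernel certificate). [cite: SilvermanAEC2009, VII.1 Remark 1.1] -/
theorem isGloballyMinimal_ninetySixA1 : (⟨0, 1, 0, -2, 0⟩ : WeierstrassCurve ℚ).IsGloballyMinimal := by
  rw [mk_ninetySixA1_eq_cast]
  exact IntModelCond.isGloballyMinimal_mk_of_minCheck 0 (1) 0 (-2) 0 (cm := ⟨6, 4, 7, [⟨3, 1, 2, 2, 0⟩]⟩) (by decide +kernel)

/-- `96a1` is an elliptic curve (`Δ = 576 ≠ 0`); a theorem, use `haveI`. [folklore] -/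
theorem isElliptic_ninetySixA1 : (⟨0, 1, 0, -2, 0⟩ : WeierstrassCurve ℚ).IsElliptic :=
  ⟨by norm_num [WeierstrassCurve.Δ, WeierstrassCurve.b₂, WeierstrassCurve.b₄, WeierstrassCurve.b₆, WeierstrassCurve.b₈]⟩

/-- **`N(96a1) = 96 = 2⁵·3`**: Step-3 certificate at `2` (no translation; `4 ∣ a₆`, `2² ∥ b₈`: type `III`, `f₂ = 5`) and the multiplicative certificate
at `3` (`3 ∣ Δ`, `3 ∤ c₄`); kernel-checked, minimality included. [cite: Silverman1994, IV.9.4] [cite: CremonaAlgorithms1997, Table 1 (96a1)] -/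
theorem conductorNorm_ninetySixA1 : (⟨0, 1, 0, -2, 0⟩ : WeierstrassCurve ℚ).conductorNorm ℤ = 96 := by
  rw [mk_ninetySixA1_eq_cast]
  exact IntModelCond.conductorNorm_mk_eq_of_certs_of_eq 0 (1) 0 (-2) 0
    (cm := ⟨6, 4, 7, [⟨3, 1, 2, 2, 0⟩]⟩) (c := ⟨6, 4, 7, 2, 0, 0, []⟩)
    (l₂ := ⟨2, 0, 0, 0, 6, 3, 2⟩) (l₃ := ⟨1, 0, 0, 0, 0, 0, 0⟩)
    (by decide +kernel) (by decide +kernel) (by decide +kernel) (by decide +kernel) (by decide +kernel)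

/-- **The Néron invariants of `96a1`**: `c₄ = 112`, `c₆ = -640`; `(g₂, g₃) = (28/3, -80/27) ⟹ IsNeronLatticeOf`. [cite: CremonaAlgorithms1997, Table 1 (96a1)] -/
theorem isNeronLatticeOf_ninetySixA1 {L₁ : PeriodPair} (hg2 : L₁.g₂ = 28 / 3) (hg3 : L₁.g₃ = -80 / 27) :
    IsNeronLatticeOf ((⟨0, 1, 0, -2, 0⟩ : WeierstrassCurve ℚ).baseChange ℂ) L₁ := by
  constructor
  · rw [hg2]
    norm_num [WeierstrassCurve.baseChange, WeierstrassCurve.map_c₄, WeierstrassCurve.c₄,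
      WeierstrassCurve.b₂, WeierstrassCurve.b₄]
  · rw [hg3]
    norm_num [WeierstrassCurve.baseChange, WeierstrassCurve.map_c₆, WeierstrassCurve.c₆,
      WeierstrassCurve.b₂, WeierstrassCurve.b₄, WeierstrassCurve.b₆]

/-! ## §2 The squeeze for the class `96a` -/

/-- **`|c| = 1` for every `X₀(96)`-datum whose newform is `φ₉₆a`** — UNCONDITIONAL. [cite: AgasheRibetStein2006, §§1–2] -/
theorem abs_maninConstant_eq_one_ninetySixA_of_f_eq (W : WeierstrassCurve ℚ) [W.IsElliptic] [W.IsGloballyMinimal]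
    (D : ModularParametrizationData W 96)
    (hf : ⇑D.f = fun τ ↦ (etaQuotient 96 (expFn [(4, 2), (8, -3), (12, -4), (16, 1), (24, 11), (48, -3)]) τ + etaQuotient 96 (expFn [(4, 1), (8, -1), (12, -1), (24, 3), (32, 2), (48, 2), (96, -2)]) τ + etaQuotient 96 (expFn [(4, 1), (8, -3), (12, -1), (16, 6), (24, 5), (32, -2), (48, -4), (96, 2)]) τ + 2 * etaQuotient 96 (expFn [(2, 1), (4, -2), (6, -3), (8, 2), (12, 8), (16, -1), (24, -4), (48, 3)]) τ))
    (hopt : ∀ z ∈ D.L.lattice, ∃ w ∈ periodLattice D.f, z = D.c * w) :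
    |D.maninConstant| = 1 := by
  haveI := isElliptic_ninetySixA1
  haveI := isGloballyMinimal_ninetySixA1
  obtain ⟨L₁, hg2, hg3, hle⟩ := periodLatticeLe_ninetySix D.f hf
  exact NeronSqueeze.abs_maninConstant_eq_one_of_periodLattice_le (⟨0, 1, 0, -2, 0⟩ : WeierstrassCurve ℚ) L₁
    (isNeronLatticeOf_ninetySixA1 hg2 hg3) W D hle hopt

/-- `2 ∤ c` and `3 ∤ c` for every `X₀(96)`-datum whose newform is `φ₉₆a` — UNCONDITIONAL. [folklore] -/
theorem not_dvd_maninConstant_ninetySixA_of_f_eq (W : WeierstrassCurve ℚ) [W.IsElliptic] [W.IsGloballyMinimal]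
    (D : ModularParametrizationData W 96)
    (hf : ⇑D.f = fun τ ↦ (etaQuotient 96 (expFn [(4, 2), (8, -3), (12, -4), (16, 1), (24, 11), (48, -3)]) τ + etaQuotient 96 (expFn [(4, 1), (8, -1), (12, -1), (24, 3), (32, 2), (48, 2), (96, -2)]) τ + etaQuotient 96 (expFn [(4, 1), (8, -3), (12, -1), (16, 6), (24, 5), (32, -2), (48, -4), (96, 2)]) τ + 2 * etaQuotient 96 (expFn [(2, 1), (4, -2), (6, -3), (8, 2), (12, 8), (16, -1), (24, -4), (48, 3)]) τ))
    (hopt : ∀ z ∈ D.L.lattice, ∃ w ∈ periodLattice D.f, z = D.c * w) :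
    ¬ (2 : ℤ) ∣ D.maninConstant ∧ ¬ (3 : ℤ) ∣ D.maninConstant := by
  have h := abs_maninConstant_eq_one_ninetySixA_of_f_eq W D hf hopt
  refine ⟨fun h2 ↦ ?_, fun h3 ↦ ?_⟩
  · have := Int.le_of_dvd (by rw [h]; norm_num) ((dvd_abs _ _).mpr h2)
    rw [h] at this
    norm_num at this
  · have := Int.le_of_dvd (by rw [h]; norm_num) ((dvd_abs _ _).mpr h3)
    rw [h] at this
    norm_num at this

/-- **Modularity at `96a1`, levelled**: under `exists_isNewformOf`, the curve has a newform in `S₂(Γ₀(96))`.  CONDITIONAL on the items' binder.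
[cite: DiamondShurman2005, Thm. 8.8.3] -/
theorem exists_isNewformOf_ninetySixA1 (hnf : exists_isNewformOf) :
    ∃ f : CuspForm (Gamma0 96) 2, IsNewformOf (⟨0, 1, 0, -2, 0⟩ : WeierstrassCurve ℚ) f := by
  haveI := isElliptic_ninetySixA1
  have key : ∀ (N : ℕ) [NeZero N], (⟨0, 1, 0, -2, 0⟩ : WeierstrassCurve ℚ).conductorNorm ℤ = N →
      ∃ f : CuspForm (Gamma0 N) 2, IsNewformOf (⟨0, 1, 0, -2, 0⟩ : WeierstrassCurve ℚ) f := by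
    intro N _ hN
    subst hN
    exact hnf _
  haveI : NeZero (96 : ℕ) := ⟨by decide⟩
  exact key 96 conductorNorm_ninetySixA1

end Summit.BirchSwinnertonDyer.BirchSwinnertonDyer.Theorems.ManinLocalTwoThree.NeronSqueezeNinetySixA

end
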